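import Summits.QuantumFields.BalabanUV.T4Continuum.Support.VariationalOneStepInterpolant
import HarnessLib

/-!
# NE3SlicePoincareBudget (T⁴ programme, node NE3, row K6 of ruling ρ-g22-2, part K6c-2a of the cut ρ-g23-3 §3) — THE REAL ARITHMETIC OF THE (P♮)_W BUDGET,
# LETTERS ONLY: five Young inequalities, the h-bound, the y-bound, and the absorption

Leaf seat `b2b-balaban-t4-ne3-formalise-leaf-02` (gen 6), row K6 (blueprint `HOME/t4/b2b-balaban-t4-ne3-p1/g23/D-ne3p1-g23-1.md` (S8); derivation
`HOME/t4/b2b-balaban-t4-ne3-formalise-leaf-02/g6/K6c-BUDGET.md`).  NO lattice object occurs in this file: every hypothesis is the LETTER form of a landed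
inequality of route H♮ — (K1) `NE3SpectralCutTorus.exists_covHodge_cut` (`y = h + G`, `ϑZ ≤ y`, `r ≤ ϑy`, `ϑ = ε²∕M²`), (S5) `NE3SlicePoincareGradientBudget.covFd_energy_le`,
(η) `NE3SlicePoincareEtaBound.eta_sq_le`, (y)(Ξ) `NE3SlicePoincareYBound`, (G̃) `NE3SlicePoincareCompetitorEnd.exists_competitor`, Jensen `A1 ≤ Z` — with the composite
coefficients abstracted to nonnegative reals, so that K6c-2b instantiates by `exact`.  All [folklore], 0 sorry, 0 def:
§1 `two_sqrt_mul_sqrt_le` (`2√a√b ≤ t·a + b∕t`); §2 `h_bound` (Young weights `64∕M²`, `M²∕ε`, `1∕M`, `ε²M^d∕M²`):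
`h ≤ 4·A·(M²P) + S_h·h + S_y·y`; §3 `B5_le` and `y_bound` (weight `M²∕ε`): `y ≤ K_h·h + s₂·y`; §4 `absorb`: `S_h ≤ 1∕2`, `2K_hS_y + s₂ ≤ 1∕2` ⟹ `y ≤ 16·A·K_h·(M²P)`.
HONEST FRAMING.  Elementary real inequalities; nothing about Bałaban's minimisers; (P♮)_W, (ML_w) at `W ≠ 1`, T-E_w and NE3 are NOT proved; spine PROVED 0∕9;
finite T⁴ rung (B)+1 — NOT infinite volume, NOT mass gap, NOT BetaPertH, NOT Clay.  PLACEMENT: `Summits/QuantumFields/BalabanUV/`.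
HONEST DEPENDENCY: continuum YM on T⁴ ⇐ BetaPertH ∧ nine spine estimates (0/9 proved); BetaPertH ⇐ (D1) ∧ (D4) ∧ CAP+tail; G-an2-4 gates asym, D1 and NE2/3/4.
-/

set_option autoImplicit false

namespace Summit.QuantumFields.BalabanUV.T4Continuum.NE3SlicePoincareBudget

/-! ## §1 Young: `VariationalOneStepInterpolant.two_sqrt_mul_sqrt_le` (`2·(√a·√b) ≤ t·a + b∕t`), BY NAME -/

open VariationalOneStepInterpolant (two_sqrt_mul_sqrt_le)

/-! ## §2 The h-bound -/

/-- **THE h-BOUND** (letters; K6c-BUDGET.md §4).  From (K1), (S5) with abstract `q1, q2`, `DG ≤ CG`, Jensen `A1 ≤ Z`, `A1 = M^d·A2`, and (η) with its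
composite coefficients abstracted (`c1, e1, e2, e3, K, cx, scd, cf, sc ≥ 0`):
`h ≤ 4A·(M²P) + S_h·h + S_y·y` with `A = 18 + 1∕4 + 16·cf·sc∕ε²`,
`S_h = c1 + 1∕4 + 512e1·cn∕M² + 16cx·scd·M + 16cf·sc∕ε² + A·(q2·cn·M²)`,
`S_y = 512e2·cn∕M² + 512e3·cn∕ε² + 24ε + 8K∕ε + 16cx·scd·M∕ε² + 8cf·sc·d + A·(q1·M⁴∕ε² + ε²)`. [folklore] -/
theorem h_bound {d : ℕ} (hd : 1 ≤ d) {M ε cn y h G Z r CG DG P A1 A2 c1 e1 e2 e3 K cx scd cf sc q1 q2 : ℝ}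
    (hM : 0 < M) (hε : 0 < ε) (hcn : 0 ≤ cn) (hy : 0 ≤ y) (hh : 0 ≤ h) (hG : 0 ≤ G) (hZ0 : 0 ≤ Z) (hr0 : 0 ≤ r)
    (hDG0 : 0 ≤ DG) (hA10 : 0 ≤ A1) (hA20 : 0 ≤ A2) (he1 : 0 ≤ e1) (he2 : 0 ≤ e2) (he3 : 0 ≤ e3) (hK : 0 ≤ K)
    (hcx : 0 ≤ cx) (hscd : 0 ≤ scd) (hcf : 0 ≤ cf) (hsc : 0 ≤ sc) (hq1 : 0 ≤ q1)
    (hpy : y = h + G) (hZ : ε ^ 2 / M ^ 2 * Z ≤ y) (hr : r ≤ ε ^ 2 / M ^ 2 * y)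
    (hS5 : CG ≤ 4 * P + q1 * Z + r + q2 * (cn * h)) (hDG : DG ≤ CG) (hJ : A1 ≤ Z) (hA : A1 = M ^ d * A2)
    (heta : h ≤ 18 * M ^ 2 * CG + c1 * h
        + 16 * (Real.sqrt (e1 * (cn * h) + e2 * (cn * y) + e3 * (cn * Z)) * Real.sqrt (2 * (M ^ 2)⁻¹ * h + 2 * DG))
        + 16 * (Real.sqrt r * Real.sqrt (2 * M ^ 2 * G + K * Z))
        + 16 * (2 * cx * scd * Real.sqrt A1 * Real.sqrt h)
        + 16 * (cf * sc * (Real.sqrt ((d : ℝ) * A2) * Real.sqrt (M ^ (d - 1) * (2 / M * h + 2 * M * DG))))) :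
    h ≤ 4 * (18 + 1 / 4 + 16 * cf * sc / ε ^ 2) * (M ^ 2 * P)
      + (c1 + 1 / 4 + 512 * e1 * cn / M ^ 2 + 16 * cx * scd * M + 16 * cf * sc / ε ^ 2
          + (18 + 1 / 4 + 16 * cf * sc / ε ^ 2) * (q2 * cn * M ^ 2)) * h
      + (512 * e2 * cn / M ^ 2 + 512 * e3 * cn / ε ^ 2 + 24 * ε + 8 * K / ε + 16 * cx * scd * M / ε ^ 2 + 8 * cf * sc * d
          + (18 + 1 / 4 + 16 * cf * sc / ε ^ 2) * (q1 * M ^ 4 / ε ^ 2 + ε ^ 2)) * y := by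
  have hM2 : 0 < M ^ 2 := by positivity
  have hMd : 0 < M ^ d := by positivity
  have hMdm : M ^ (d - 1) * M = M ^ d := pow_sub_one_mul (by omega) M
  have hd0 : (0 : ℝ) ≤ d := by positivity
  -- the letters on the right
  have hGy : G ≤ y := by linarith only [hpy, hh]
  have hZy : Z ≤ M ^ 2 / ε ^ 2 * y := by
    have := mul_le_mul_of_nonneg_left hZ (show 0 ≤ M ^ 2 / ε ^ 2 by positivity)
    have e : M ^ 2 / ε ^ 2 * (ε ^ 2 / M ^ 2 * Z) = Z := by field_simp
    linarith only [this, e]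
  have hA1y : A1 ≤ M ^ 2 / ε ^ 2 * y := hJ.trans hZy
  obtain ⟨E, hE⟩ : ∃ E : ℝ, E = e1 * (cn * h) + e2 * (cn * y) + e3 * (cn * Z) := ⟨_, rfl⟩
  obtain ⟨Φ, hΦ⟩ : ∃ Φ : ℝ, Φ = 2 * (M ^ 2)⁻¹ * h + 2 * DG := ⟨_, rfl⟩
  have hE0 : 0 ≤ E := by rw [hE]; positivity
  have hΦ0 : 0 ≤ Φ := by rw [hΦ]; positivity
  rw [← hE, ← hΦ] at heta
  -- (Y1)
  have y1 : 16 * (Real.sqrt E * Real.sqrt Φ) ≤ 8 * (64 / M ^ 2 * E + Φ / (64 / M ^ 2)) := by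
    have h := two_sqrt_mul_sqrt_le hE0 hΦ0 (show 0 < 64 / M ^ 2 by positivity)
    linarith only [h]
  have y1' : 8 * (64 / M ^ 2 * E + Φ / (64 / M ^ 2)) = 512 * E / M ^ 2 + (1 / 4) * h + (1 / 4) * (M ^ 2 * DG) := by
    rw [hΦ]; field_simp; ring
  -- (Y2)
  have hB20 : 0 ≤ 2 * M ^ 2 * G + K * Z := by positivity
  have y2 : 16 * (Real.sqrt r * Real.sqrt (2 * M ^ 2 * G + K * Z)) ≤ 8 * (M ^ 2 / ε * r + (2 * M ^ 2 * G + K * Z) / (M ^ 2 / ε)) := by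
    have h := two_sqrt_mul_sqrt_le hr0 hB20 (show 0 < M ^ 2 / ε by positivity)
    linarith only [h]
  have y2' : 8 * (M ^ 2 / ε * r + (2 * M ^ 2 * G + K * Z) / (M ^ 2 / ε)) = 8 * M ^ 2 / ε * r + 16 * ε * G + 8 * ε * K / M ^ 2 * Z := by
    field_simp; ring
  -- (Y3)
  have y3 : 16 * (2 * cx * scd * Real.sqrt A1 * Real.sqrt h) ≤ 16 * cx * scd * (1 / M * A1 + h / (1 / M)) := by
    have h1 := two_sqrt_mul_sqrt_le hA10 hh (show 0 < 1 / M by positivity)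
    have h0 : 0 ≤ 16 * cx * scd := by positivity
    have h2 := mul_le_mul_of_nonneg_left h1 h0
    linarith only [h2]
  have y3' : 16 * cx * scd * (1 / M * A1 + h / (1 / M)) = 16 * cx * scd / M * A1 + 16 * cx * scd * M * h := by
    field_simp
  -- (Y4)
  have hdA2 : 0 ≤ (d : ℝ) * A2 := by positivity
  have hX0 : 0 ≤ M ^ (d - 1) * (2 / M * h + 2 * M * DG) := by positivity
  have y4 : 16 * (cf * sc * (Real.sqrt ((d : ℝ) * A2) * Real.sqrt (M ^ (d - 1) * (2 / M * h + 2 * M * DG))))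
      ≤ 8 * cf * sc * (ε ^ 2 * M ^ d / M ^ 2 * ((d : ℝ) * A2) + M ^ (d - 1) * (2 / M * h + 2 * M * DG) / (ε ^ 2 * M ^ d / M ^ 2)) := by
    have h1 := two_sqrt_mul_sqrt_le hdA2 hX0 (show 0 < ε ^ 2 * M ^ d / M ^ 2 by positivity)
    have h0 : 0 ≤ 8 * cf * sc := by positivity
    have h2 := mul_le_mul_of_nonneg_left h1 h0
    linarith only [h2]
  have y4' : 8 * cf * sc * (ε ^ 2 * M ^ d / M ^ 2 * ((d : ℝ) * A2) + M ^ (d - 1) * (2 / M * h + 2 * M * DG) / (ε ^ 2 * M ^ d / M ^ 2))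
      = 8 * cf * sc * d * (ε ^ 2 / M ^ 2) * A1 + 16 * cf * sc / ε ^ 2 * h + 16 * cf * sc / ε ^ 2 * (M ^ 2 * DG) := by
    rw [hA, ← hMdm]
    field_simp; ring
  -- the root-free η-bound
  have heta' : h ≤ 18 * M ^ 2 * CG + c1 * h + (512 * E / M ^ 2 + (1 / 4) * h + (1 / 4) * (M ^ 2 * DG))
      + (8 * M ^ 2 / ε * r + 16 * ε * G + 8 * ε * K / M ^ 2 * Z) + (16 * cx * scd / M * A1 + 16 * cx * scd * M * h)
      + (8 * cf * sc * d * (ε ^ 2 / M ^ 2) * A1 + 16 * cf * sc / ε ^ 2 * h + 16 * cf * sc / ε ^ 2 * (M ^ 2 * DG)) := by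
    linarith only [heta, y1, y1', y2, y2', y3, y3', y4, y4']
  -- substitute the letters
  have s1 : 512 * E / M ^ 2 ≤ 512 * e1 * cn / M ^ 2 * h + 512 * e2 * cn / M ^ 2 * y + 512 * e3 * cn / ε ^ 2 * y := by
    have hZ' := mul_le_mul_of_nonneg_left hZy (show 0 ≤ 512 * e3 * cn / M ^ 2 by positivity)
    have e : 512 * e3 * cn / M ^ 2 * (M ^ 2 / ε ^ 2 * y) = 512 * e3 * cn / ε ^ 2 * y := by field_simp
    have eE : 512 * E / M ^ 2 = 512 * e1 * cn / M ^ 2 * h + 512 * e2 * cn / M ^ 2 * y + 512 * e3 * cn / M ^ 2 * Z := by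
      rw [hE]; field_simp
    linarith only [hZ', e, eE]
  have s2 : 8 * M ^ 2 / ε * r ≤ 8 * ε * y := by
    have := mul_le_mul_of_nonneg_left hr (show 0 ≤ 8 * M ^ 2 / ε by positivity)
    have e : 8 * M ^ 2 / ε * (ε ^ 2 / M ^ 2 * y) = 8 * ε * y := by field_simp
    linarith only [this, e]
  have s3 : 8 * ε * K / M ^ 2 * Z ≤ 8 * K / ε * y := by
    have := mul_le_mul_of_nonneg_left hZy (show 0 ≤ 8 * ε * K / M ^ 2 by positivity)
    have e : 8 * ε * K / M ^ 2 * (M ^ 2 / ε ^ 2 * y) = 8 * K / ε * y := by field_simp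
    linarith only [this, e]
  have s4 : 16 * cx * scd / M * A1 ≤ 16 * cx * scd * M / ε ^ 2 * y := by
    have := mul_le_mul_of_nonneg_left hA1y (show 0 ≤ 16 * cx * scd / M by positivity)
    have e : 16 * cx * scd / M * (M ^ 2 / ε ^ 2 * y) = 16 * cx * scd * M / ε ^ 2 * y := by field_simp
    linarith only [this, e]
  have s5 : 8 * cf * sc * d * (ε ^ 2 / M ^ 2) * A1 ≤ 8 * cf * sc * d * y := by
    have := mul_le_mul_of_nonneg_left hA1y (show 0 ≤ 8 * cf * sc * d * (ε ^ 2 / M ^ 2) by positivity)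
    have e : 8 * cf * sc * d * (ε ^ 2 / M ^ 2) * (M ^ 2 / ε ^ 2 * y) = 8 * cf * sc * d * y := by field_simp
    linarith only [this, e]
  have s6 : 16 * ε * G ≤ 16 * ε * y := mul_le_mul_of_nonneg_left hGy (by positivity)
  have s7 : M ^ 2 * DG ≤ M ^ 2 * CG := mul_le_mul_of_nonneg_left hDG hM2.le
  -- (S5) × M²
  have s8 : M ^ 2 * CG ≤ 4 * (M ^ 2 * P) + q1 * M ^ 4 / ε ^ 2 * y + ε ^ 2 * y + q2 * cn * M ^ 2 * h := by
    have h1 := mul_le_mul_of_nonneg_left hS5 hM2.le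
    have h2 := mul_le_mul_of_nonneg_left hZy (show 0 ≤ M ^ 2 * q1 by positivity)
    have e2 : M ^ 2 * q1 * (M ^ 2 / ε ^ 2 * y) = q1 * M ^ 4 / ε ^ 2 * y := by field_simp
    have h3 := mul_le_mul_of_nonneg_left hr hM2.le
    have e3 : M ^ 2 * (ε ^ 2 / M ^ 2 * y) = ε ^ 2 * y := by field_simp
    linarith only [h1, h2, e2, h3, e3]
  -- collect: the `M²CG` coefficient is `A = 18 + 1/4 + 16 cf sc / ε²`
  have hAcg0 : 0 ≤ 18 + 1 / 4 + 16 * cf * sc / ε ^ 2 := by positivity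
  have s9 := mul_le_mul_of_nonneg_left s8 hAcg0
  have s7' := mul_le_mul_of_nonneg_left s7 (show 0 ≤ 1 / 4 + 16 * cf * sc / ε ^ 2 by positivity)
  linarith only [heta', s1, s2, s3, s4, s5, s6, s7', s9]

/-! ## §3 The competitor's energy and the y-bound -/

/-- **`B₅ ≤ b_h·h + b_y·y`** (letters; the structure of K6c-1b-β's `B₅` with abstract nonnegative coefficients `p1, dK1, HL, dκ, s64, p3, pK2, e1, e2, e3`). [folklore] -/
theorem B5_le {d : ℕ} {M ε cn y h Z e1 e2 e3 p1 dK1 HL dκ s64 p3 pK2 : ℝ} (hM : 0 < M)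
    (hcn : 0 ≤ cn) (he3 : 0 ≤ e3) (hp1 : 0 ≤ p1) (hdK1 : 0 ≤ dK1) (hdκ : 0 ≤ dκ) (hs64 : 0 ≤ s64) (hp3 : 0 ≤ p3) (hpK2 : 0 ≤ pK2)
    (hZy : Z ≤ M ^ 2 / ε ^ 2 * y) :
    3 * (p1 * (M ^ 2)⁻¹ * (cn * (2 * M ^ 2 * h + 2 * (e1 * (cn * h) + e2 * (cn * y) + e3 * (cn * Z)))) + dK1 * (cn * Z))
        + 12 * d * (HL * (cn * h))
        + 3 * dκ * (2 * s64 * (p3 * d * (cn * (2 * M ^ 2 * h + 2 * (e1 * (cn * h) + e2 * (cn * y) + e3 * (cn * Z)))) + pK2 * (cn * Z))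
            + 2 * s64 * (HL * (cn * h)))
      ≤ ((3 * p1 * (M ^ 2)⁻¹ + 3 * dκ * (2 * s64 * (p3 * d))) * (cn * (2 * M ^ 2 + 2 * e1 * cn)) + (12 * d * HL + 3 * dκ * (2 * s64 * HL)) * cn) * h
        + ((3 * p1 * (M ^ 2)⁻¹ + 3 * dκ * (2 * s64 * (p3 * d))) * (cn * (2 * e2 * cn) + cn * (2 * e3 * cn) * (M ^ 2 / ε ^ 2))
            + (3 * dK1 + 3 * dκ * (2 * s64 * pK2)) * cn * (M ^ 2 / ε ^ 2)) * y := by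
  have hd0 : (0 : ℝ) ≤ d := by positivity
  have hβD : 0 ≤ 3 * p1 * (M ^ 2)⁻¹ + 3 * dκ * (2 * s64 * (p3 * d)) := by positivity
  have hβZ : 0 ≤ 3 * dK1 + 3 * dκ * (2 * s64 * pK2) := by positivity
  -- the three substitutions `Z ≤ (M²/ε²) y`
  have z1 := mul_le_mul_of_nonneg_left hZy (show 0 ≤ (3 * p1 * (M ^ 2)⁻¹ + 3 * dκ * (2 * s64 * (p3 * d))) * (cn * (2 * e3 * cn)) by positivity)
  have z2 := mul_le_mul_of_nonneg_left hZy (show 0 ≤ (3 * dK1 + 3 * dκ * (2 * s64 * pK2)) * cn by positivity)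
  have e0 : 3 * (p1 * (M ^ 2)⁻¹ * (cn * (2 * M ^ 2 * h + 2 * (e1 * (cn * h) + e2 * (cn * y) + e3 * (cn * Z)))) + dK1 * (cn * Z))
        + 12 * d * (HL * (cn * h))
        + 3 * dκ * (2 * s64 * (p3 * d * (cn * (2 * M ^ 2 * h + 2 * (e1 * (cn * h) + e2 * (cn * y) + e3 * (cn * Z)))) + pK2 * (cn * Z))
            + 2 * s64 * (HL * (cn * h)))
      = (3 * p1 * (M ^ 2)⁻¹ + 3 * dκ * (2 * s64 * (p3 * d))) * (cn * (2 * M ^ 2 + 2 * e1 * cn)) * h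
        + (3 * p1 * (M ^ 2)⁻¹ + 3 * dκ * (2 * s64 * (p3 * d))) * (cn * (2 * e2 * cn)) * y
        + (3 * p1 * (M ^ 2)⁻¹ + 3 * dκ * (2 * s64 * (p3 * d))) * (cn * (2 * e3 * cn)) * Z
        + (3 * dK1 + 3 * dκ * (2 * s64 * pK2)) * cn * Z
        + (12 * d * HL + 3 * dκ * (2 * s64 * HL)) * cn * h := by ring
  rw [e0]
  nlinarith [z1, z2]

/-- **THE y-BOUND** (letters; K6c-BUDGET.md §5): from (y), (Ξ), the competitor END with abstract `gq, gz`, `B₅ ≤ b_h·h + b_y·y`, `G ≤ y`, `Z ≤ (M²∕ε²)y`,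
`r ≤ (ε²∕M²)y` (Young weight `M²∕ε`): `y ≤ K_h·h + s₂·y`. [folklore] -/
theorem y_bound {M ε y h G Z r Gt Xi B5 gq gz bh bq : ℝ} (hM : 0 < M) (hε : 0 < ε) (hr0 : 0 ≤ r) (hXi0 : 0 ≤ Xi)
    (hgq : 0 ≤ gq) (hgz : 0 ≤ gz) (hGy : G ≤ y) (hZy : Z ≤ M ^ 2 / ε ^ 2 * y) (hr : r ≤ ε ^ 2 / M ^ 2 * y)
    (hyb : y ≤ h + Gt + 2 * (Real.sqrt r * Real.sqrt Xi)) (hXi : Xi ≤ 4 * (M ^ 2 * (2 * Gt + 2 * G)))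
    (hGt : Gt ≤ 2 * B5 + gq * (8 * M ^ 2 * B5 + 8 * M ^ 2 * G + gz * Z)) (hB5 : B5 ≤ bh * h + bq * y) :
    y ≤ (1 + (1 + 8 * ε) * (2 + gq * 8 * M ^ 2) * bh) * h
      + ((1 + 8 * ε) * ((2 + gq * 8 * M ^ 2) * bq + (gq * 8 * M ^ 2 + gq * gz * (M ^ 2 / ε ^ 2))) + 9 * ε) * y := by
  -- (Y5)
  have y5 : 2 * (Real.sqrt r * Real.sqrt Xi) ≤ M ^ 2 / ε * r + Xi / (M ^ 2 / ε) :=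
    two_sqrt_mul_sqrt_le hr0 hXi0 (by positivity)
  have s1 : M ^ 2 / ε * r ≤ ε * y := by
    have h1 := mul_le_mul_of_nonneg_left hr (show 0 ≤ M ^ 2 / ε by positivity)
    have e : M ^ 2 / ε * (ε ^ 2 / M ^ 2 * y) = ε * y := by field_simp
    linarith only [h1, e]
  have s2 : Xi / (M ^ 2 / ε) ≤ 8 * ε * Gt + 8 * ε * y := by
    have h1 : Xi / (M ^ 2 / ε) = ε / M ^ 2 * Xi := by field_simp
    have h2 := mul_le_mul_of_nonneg_left hXi (show 0 ≤ ε / M ^ 2 by positivity)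
    have e : ε / M ^ 2 * (4 * (M ^ 2 * (2 * Gt + 2 * G))) = 8 * ε * Gt + 8 * ε * G := by field_simp; ring
    have h3 := mul_le_mul_of_nonneg_left hGy (show 0 ≤ 8 * ε by positivity)
    linarith only [h1, h2, e, h3]
  have hy' : y ≤ h + (1 + 8 * ε) * Gt + 9 * ε * y := by linarith only [hyb, y5, s1, s2]
  -- the competitor
  have g1 : Gt ≤ (2 + gq * 8 * M ^ 2) * (bh * h + bq * y) + gq * 8 * M ^ 2 * y + gq * gz * (M ^ 2 / ε ^ 2) * y := by
    have h1 := mul_le_mul_of_nonneg_left hB5 (show 0 ≤ 2 + gq * 8 * M ^ 2 by positivity)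
    have h2 := mul_le_mul_of_nonneg_left hGy (show 0 ≤ gq * 8 * M ^ 2 by positivity)
    have h3 := mul_le_mul_of_nonneg_left hZy (show 0 ≤ gq * gz by positivity)
    linarith only [hGt, h1, h2, h3]
  have g2 := mul_le_mul_of_nonneg_left g1 (show 0 ≤ 1 + 8 * ε by positivity)
  linarith only [hy', g2]

/-! ## §4 The absorption -/

/-- **THE ABSORPTION**: `h ≤ 4A(M²P) + S_h·h + S_y·y`, `y ≤ K_h·h + s₂·y`, `S_h ≤ 1∕2`, `2K_hS_y + s₂ ≤ 1∕2` ⟹ `y ≤ 16·A·K_h·(M²P)`. [folklore] -/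
theorem absorb {y h MP A Sh Sy Kh s2 : ℝ} (hy : 0 ≤ y) (hh0 : 0 ≤ h) (hKh : 0 ≤ Kh)
    (hh : h ≤ 4 * A * MP + Sh * h + Sy * y) (hyb : y ≤ Kh * h + s2 * y) (hSh : Sh ≤ 1 / 2) (hSy : 2 * Kh * Sy + s2 ≤ 1 / 2) :
    y ≤ 16 * A * Kh * MP := by
  have h1 := mul_le_mul_of_nonneg_left hSh hh0
  have h2 : h ≤ 8 * A * MP + 2 * Sy * y := by nlinarith [hh, h1]
  have h3 := mul_le_mul_of_nonneg_left h2 hKh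
  have h4 := mul_le_mul_of_nonneg_left hSy hy
  nlinarith [hyb, h3, h4]

/-! ## §5 The budget with every coefficient written out -/

set_option maxHeartbeats 1600000 in
/-- **THE BUDGET OF ROUTE H♮'s (P♮)_W IN THE K6 LETTERS** (K6c-BUDGET.md): the hypotheses are, token for token, the letter forms of (K1) `exists_covHodge_cut`
(cut `ϑ = ε²∕M²`), (S5) `covFd_energy_le`, `DG ≤ CG`, Jensen, `A1 = M^d·A2`, (η) `eta_sq_le`, (y) `y_sq_le`, (Ξ) `xi_sq_le`, (G̃) `exists_competitor`
(`M = L^{k+1}`, `c = card n`, sums ↦ letters), plus the two DISPLAYED SMALLNESS CONDITIONS `S_h ≤ 1∕2` and `2K_h·S_y + s₂ ≤ 1∕2`; the conclusion is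
`y ≤ 16·A·K_h·(M²·P)` with `A = 18 + 1∕4 + 16·c_f·√c∕ε²`.  Elementary; K6c-2b instantiates it by `exact`. [folklore] -/
theorem budget {d L c : ℕ} (hd : 1 ≤ d) {M ε x lr DS S2 Λ aU y h G Z r CG DG P A1 A2 Gt Xi : ℝ}
    (hM : 2 ≤ M) (hε : 0 < ε) (hc : 1 ≤ (c : ℝ)) (hx : 0 ≤ x) (hlr : 0 ≤ lr) (hΛ : 0 ≤ Λ)
    (hy0 : 0 ≤ y) (hh0 : 0 ≤ h) (hG0 : 0 ≤ G) (hZ0 : 0 ≤ Z) (hr0 : 0 ≤ r) (hDG0 : 0 ≤ DG) (hA10 : 0 ≤ A1) (hA20 : 0 ≤ A2) (hXi0 : 0 ≤ Xi)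
    (hpy : y = h + G) (hZ : ε ^ 2 / M ^ 2 * Z ≤ y) (hr : r ≤ ε ^ 2 / M ^ 2 * y)
    (hS5 : CG ≤ 4 * P + 16 * (d : ℝ) ^ 2 * x ^ 2 * Z + r + (2 * d * x + 32 * d * x ^ 2) * ((c : ℝ) * h))
    (hDG : DG ≤ CG) (hJ : A1 ≤ Z) (hA : A1 = M ^ d * A2)
    (heta : h ≤ 18 * M ^ 2 * CG
        + (80 * d + 448) * (d : ℝ) ^ 2 * (M ^ 2 * x) ^ 2
            * h
        + 16 * (Real.sqrt (4 * (2 * ((4 * d + 5) / 10 * DS)) ^ 2 * M ^ 2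
                    * ((c : ℝ) * h)
                  + 16 * S2 ^ 2 * Λ
                    * ((c : ℝ) * y)
                  + 2 * ((d : ℝ) * (20 * lr) ^ 2)
                    * ((c : ℝ) * Z))
              * Real.sqrt (2 * (M ^ 2)⁻¹ * h
                  + 2 * DG))
        + 16 * (Real.sqrt (r)
              * Real.sqrt (2 * M ^ 2 * G
                  + (8 * d * (M * (((d : ℝ) - 1) * (M - 1) * x)) ^ 2
                      + 2 * ((c : ℝ) * (4 * (d : ℝ) ^ 2 * (M - 1) ^ 2 * x
                          + 16 * d * lr) ^ 2))
                    * Z))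
        + 16 * (2 * (((d : ℝ) - 1) * (M - 1) * x) * Real.sqrt ((c : ℝ) * d)
              * Real.sqrt (A1)
              * Real.sqrt (h))
        + 16 * ((2 * (8 * lr) + 2 * (2 * (((d : ℝ) - 1) * (M - 1) * M * x)))
              * Real.sqrt ((c : ℝ))
              * (Real.sqrt ((d : ℝ) * A2)
                * Real.sqrt (M ^ (d - 1) * (2 / M * h
                    + 2 * M * DG)))))
    (hyb : y ≤ h + Gt + 2 * (Real.sqrt r * Real.sqrt Xi))
    (hXi : Xi ≤ 4 * (M ^ 2 * (2 * Gt + 2 * G)))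
    (hGt : Gt ≤ 2 * (3 * ((2 : ℝ) ^ (d + 1) * (M ^ 2)⁻¹ * ((c : ℝ) * (2 * M ^ 2 * h + 2 * (4 * (2 * ((4 * d + 5) / 10 * DS)) ^ 2 * M ^ 2 * ((c : ℝ) * h) + 16 * S2 ^ 2 * Λ * ((c : ℝ) * y) + 2 * ((d : ℝ) * (20 * lr) ^ 2) * ((c : ℝ) * Z)))) + (d : ℝ) * (2 : ℝ) ^ d * (8 * ((d : ℝ) * M * x) ^ 2 + (16 / M ^ 2) * (8 * lr + 9 * (d : ℝ) ^ 2 * M ^ 2 * x) ^ 2) * ((c : ℝ) * Z))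
        + 12 * (d : ℝ) * (48 * ((d : ℝ) * (L : ℝ)) * ((c : ℝ) * h))
        + 3 * ((d : ℝ) * (1 / M + 2 * (((d : ℝ) - 1) * (M - 1) * x)) ^ 2)
          * (2 * (64 : ℝ) ^ d * ((2 : ℝ) ^ (3 * d + 2) * d * ((c : ℝ) * (2 * M ^ 2 * h + 2 * (4 * (2 * ((4 * d + 5) / 10 * DS)) ^ 2 * M ^ 2 * ((c : ℝ) * h) + 16 * S2 ^ 2 * Λ * ((c : ℝ) * y) + 2 * ((d : ℝ) * (20 * lr) ^ 2) * ((c : ℝ) * Z)))) + (2 : ℝ) ^ d * ((2 : ℝ) ^ (2 * d + 4) * (d : ℝ) ^ 2 * ((d : ℝ) - 1) ^ 2 * (aU) ^ 2 + 8 * (9 * (d : ℝ) ^ 2 * M ^ 2 * x + (d : ℝ) * (8 * lr)) ^ 2) * ((c : ℝ) * Z))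
            + 2 * (64 : ℝ) ^ d * (48 * ((d : ℝ) * (L : ℝ)) * ((c : ℝ) * h))))
        + 16 * (d : ℝ) * (1 / M + 2 * (((d : ℝ) - 1) * (M - 1) * x)) ^ 2 * (64 : ℝ) ^ d * (4 * (d : ℝ) ^ 2 * (M - 1) ^ 2 * x + 16 * d * lr) ^ 2 * (c : ℝ)
          * (8 * M ^ 2 * (3 * ((2 : ℝ) ^ (d + 1) * (M ^ 2)⁻¹ * ((c : ℝ) * (2 * M ^ 2 * h + 2 * (4 * (2 * ((4 * d + 5) / 10 * DS)) ^ 2 * M ^ 2 * ((c : ℝ) * h) + 16 * S2 ^ 2 * Λ * ((c : ℝ) * y) + 2 * ((d : ℝ) * (20 * lr) ^ 2) * ((c : ℝ) * Z)))) + (d : ℝ) * (2 : ℝ) ^ d * (8 * ((d : ℝ) * M * x) ^ 2 + (16 / M ^ 2) * (8 * lr + 9 * (d : ℝ) ^ 2 * M ^ 2 * x) ^ 2) * ((c : ℝ) * Z))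
        + 12 * (d : ℝ) * (48 * ((d : ℝ) * (L : ℝ)) * ((c : ℝ) * h))
        + 3 * ((d : ℝ) * (1 / M + 2 * (((d : ℝ) - 1) * (M - 1) * x)) ^ 2)
          * (2 * (64 : ℝ) ^ d * ((2 : ℝ) ^ (3 * d + 2) * d * ((c : ℝ) * (2 * M ^ 2 * h + 2 * (4 * (2 * ((4 * d + 5) / 10 * DS)) ^ 2 * M ^ 2 * ((c : ℝ) * h) + 16 * S2 ^ 2 * Λ * ((c : ℝ) * y) + 2 * ((d : ℝ) * (20 * lr) ^ 2) * ((c : ℝ) * Z)))) + (2 : ℝ) ^ d * ((2 : ℝ) ^ (2 * d + 4) * (d : ℝ) ^ 2 * ((d : ℝ) - 1) ^ 2 * (aU) ^ 2 + 8 * (9 * (d : ℝ) ^ 2 * M ^ 2 * x + (d : ℝ) * (8 * lr)) ^ 2) * ((c : ℝ) * Z))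
            + 2 * (64 : ℝ) ^ d * (48 * ((d : ℝ) * (L : ℝ)) * ((c : ℝ) * h))))
            + 8 * M ^ 2 * G
            + (4 * (c : ℝ) * (4 * (d : ℝ) ^ 2 * (M - 1) ^ 2 * x + 16 * d * lr) ^ 2 + 1) * Z))
    (hSh : (((80 * d + 448) * (d : ℝ) ^ 2 * (M ^ 2 * x) ^ 2) + 1 / 4 + 512 * (4 * (2 * ((4 * d + 5) / 10 * DS)) ^ 2 * M ^ 2) * (c : ℝ) / M ^ 2 + 16 * (((d : ℝ) - 1) * (M - 1) * x) * (Real.sqrt ((c : ℝ) * d)) * M + 16 * (2 * (8 * lr) + 2 * (2 * (((d : ℝ) - 1) * (M - 1) * M * x))) * (Real.sqrt ((c : ℝ))) / ε ^ 2 + (18 + 1 / 4 + 16 * (2 * (8 * lr) + 2 * (2 * (((d : ℝ) - 1) * (M - 1) * M * x))) * (Real.sqrt ((c : ℝ))) / ε ^ 2) * ((2 * d * x + 32 * d * x ^ 2) * (c : ℝ) * M ^ 2)) ≤ 1 / 2)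
    (hSy : 2 * (1 + (1 + 8 * ε) * (2 + (16 * (d : ℝ) * (1 / M + 2 * (((d : ℝ) - 1) * (M - 1) * x)) ^ 2 * (64 : ℝ) ^ d * (4 * (d : ℝ) ^ 2 * (M - 1) ^ 2 * x + 16 * d * lr) ^ 2 * (c : ℝ)) * 8 * M ^ 2) * ((3 * ((2 : ℝ) ^ (d + 1)) * (M ^ 2)⁻¹ + 3 * ((d : ℝ) * (1 / M + 2 * (((d : ℝ) - 1) * (M - 1) * x)) ^ 2) * (2 * ((64 : ℝ) ^ d) * (((2 : ℝ) ^ (3 * d + 2)) * d))) * ((c : ℝ) * (2 * M ^ 2 + 2 * (4 * (2 * ((4 * d + 5) / 10 * DS)) ^ 2 * M ^ 2) * (c : ℝ))) + (12 * d * (48 * ((d : ℝ) * (L : ℝ))) + 3 * ((d : ℝ) * (1 / M + 2 * (((d : ℝ) - 1) * (M - 1) * x)) ^ 2) * (2 * ((64 : ℝ) ^ d) * (48 * ((d : ℝ) * (L : ℝ))))) * (c : ℝ)))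
        * (512 * (16 * S2 ^ 2 * Λ) * (c : ℝ) / M ^ 2 + 512 * (2 * ((d : ℝ) * (20 * lr) ^ 2)) * (c : ℝ) / ε ^ 2 + 24 * ε + 8 * (8 * d * (M * (((d : ℝ) - 1) * (M - 1) * x)) ^ 2 + 2 * ((c : ℝ) * (4 * (d : ℝ) ^ 2 * (M - 1) ^ 2 * x + 16 * d * lr) ^ 2)) / ε + 16 * (((d : ℝ) - 1) * (M - 1) * x) * (Real.sqrt ((c : ℝ) * d)) * M / ε ^ 2 + 8 * (2 * (8 * lr) + 2 * (2 * (((d : ℝ) - 1) * (M - 1) * M * x))) * (Real.sqrt ((c : ℝ))) * d + (18 + 1 / 4 + 16 * (2 * (8 * lr) + 2 * (2 * (((d : ℝ) - 1) * (M - 1) * M * x))) * (Real.sqrt ((c : ℝ))) / ε ^ 2) * ((16 * (d : ℝ) ^ 2 * x ^ 2) * M ^ 4 / ε ^ 2 + ε ^ 2))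
        + ((1 + 8 * ε) * ((2 + (16 * (d : ℝ) * (1 / M + 2 * (((d : ℝ) - 1) * (M - 1) * x)) ^ 2 * (64 : ℝ) ^ d * (4 * (d : ℝ) ^ 2 * (M - 1) ^ 2 * x + 16 * d * lr) ^ 2 * (c : ℝ)) * 8 * M ^ 2) * ((3 * ((2 : ℝ) ^ (d + 1)) * (M ^ 2)⁻¹ + 3 * ((d : ℝ) * (1 / M + 2 * (((d : ℝ) - 1) * (M - 1) * x)) ^ 2) * (2 * ((64 : ℝ) ^ d) * (((2 : ℝ) ^ (3 * d + 2)) * d))) * ((c : ℝ) * (2 * (16 * S2 ^ 2 * Λ) * (c : ℝ)) + (c : ℝ) * (2 * (2 * ((d : ℝ) * (20 * lr) ^ 2)) * (c : ℝ)) * (M ^ 2 / ε ^ 2)) + (3 * ((d : ℝ) * (2 : ℝ) ^ d * (8 * ((d : ℝ) * M * x) ^ 2 + (16 / M ^ 2) * (8 * lr + 9 * (d : ℝ) ^ 2 * M ^ 2 * x) ^ 2)) + 3 * ((d : ℝ) * (1 / M + 2 * (((d : ℝ) - 1) * (M - 1) * x)) ^ 2) * (2 * ((64 : ℝ) ^ d)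 * ((2 : ℝ) ^ d * ((2 : ℝ) ^ (2 * d + 4) * (d : ℝ) ^ 2 * ((d : ℝ) - 1) ^ 2 * (aU) ^ 2 + 8 * (9 * (d : ℝ) ^ 2 * M ^ 2 * x + (d : ℝ) * (8 * lr)) ^ 2)))) * (c : ℝ) * (M ^ 2 / ε ^ 2)) + ((16 * (d : ℝ) * (1 / M + 2 * (((d : ℝ) - 1) * (M - 1) * x)) ^ 2 * (64 : ℝ) ^ d * (4 * (d : ℝ) ^ 2 * (M - 1) ^ 2 * x + 16 * d * lr) ^ 2 * (c : ℝ)) * 8 * M ^ 2 + (16 * (d : ℝ) * (1 / M + 2 * (((d : ℝ) - 1) * (M - 1) * x)) ^ 2 * (64 : ℝ) ^ d * (4 * (d : ℝ) ^ 2 * (M - 1) ^ 2 * x + 16 * d * lr) ^ 2 * (c : ℝ)) * (4 * (c : ℝ) * (4 * (d : ℝ) ^ 2 * (M - 1) ^ 2 * x + 16 * d * lr) ^ 2 + 1) * (M ^ 2 / ε ^ 2))) + 9 * ε) ≤ 1 / 2) :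
    y ≤ 16 * (18 + 1 / 4 + 16 * (2 * (8 * lr) + 2 * (2 * (((d : ℝ) - 1) * (M - 1) * M * x))) * (Real.sqrt ((c : ℝ))) / ε ^ 2) * (1 + (1 + 8 * ε) * (2 + (16 * (d : ℝ) * (1 / M + 2 * (((d : ℝ) - 1) * (M - 1) * x)) ^ 2 * (64 : ℝ) ^ d * (4 * (d : ℝ) ^ 2 * (M - 1) ^ 2 * x + 16 * d * lr) ^ 2 * (c : ℝ)) * 8 * M ^ 2) * ((3 * ((2 : ℝ) ^ (d + 1)) * (M ^ 2)⁻¹ + 3 * ((d : ℝ) * (1 / M + 2 * (((d : ℝ) - 1) * (M - 1) * x)) ^ 2) * (2 * ((64 : ℝ) ^ d) * (((2 : ℝ) ^ (3 * d + 2)) * d))) * ((c : ℝ) * (2 * M ^ 2 + 2 * (4 * (2 * ((4 * d + 5) / 10 * DS)) ^ 2 * M ^ 2) * (c : ℝ))) + (12 * d * (48 * ((d : ℝ) * (L : ℝ))) + 3 * ((d : ℝ) * (1 / M + 2 * (((d : ℝ) - 1) * (M - 1) * x)) ^ 2) * (2 * ((64 : ℝ) ^ d) * (48 * ((d : ℝ)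 * (L : ℝ))))) * (c : ℝ))) * (M ^ 2 * P) := by
  have hM0 : 0 < M := by linarith only [hM]
  have hc0 : 0 ≤ (c : ℝ) := by positivity
  have hd1 : (1 : ℝ) ≤ d := by exact_mod_cast hd
  have hM1 : 1 ≤ M := by linarith only [hM]
  have hGy : G ≤ y := by linarith only [hpy, hh0]
  have hZy : Z ≤ M ^ 2 / ε ^ 2 * y := by
    have h1 := mul_le_mul_of_nonneg_left hZ (show 0 ≤ M ^ 2 / ε ^ 2 by positivity)
    have e : M ^ 2 / ε ^ 2 * (ε ^ 2 / M ^ 2 * Z) = Z := by field_simp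
    linarith only [h1, e]
  -- signs of the composite coefficients
  have hdm : (0 : ℝ) ≤ (d : ℝ) - 1 := by linarith only [hd1]
  have hMm : (0 : ℝ) ≤ M - 1 := by linarith only [hM1]
  have hcx : 0 ≤ ((d : ℝ) - 1) * (M - 1) * x := mul_nonneg (mul_nonneg hdm hMm) hx
  have hcxM : 0 ≤ ((d : ℝ) - 1) * (M - 1) * M * x := mul_nonneg (mul_nonneg (mul_nonneg hdm hMm) hM0.le) hx
  have he1 : 0 ≤ 4 * (2 * ((4 * d + 5) / 10 * DS)) ^ 2 * M ^ 2 := by positivity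
  have he2 : 0 ≤ 16 * S2 ^ 2 * Λ := by positivity
  have he3 : 0 ≤ 2 * ((d : ℝ) * (20 * lr) ^ 2) := by positivity
  have hK : 0 ≤ 8 * d * (M * (((d : ℝ) - 1) * (M - 1) * x)) ^ 2 + 2 * ((c : ℝ) * (4 * (d : ℝ) ^ 2 * (M - 1) ^ 2 * x + 16 * d * lr) ^ 2) := by positivity
  have hscd : 0 ≤ Real.sqrt ((c : ℝ) * d) := Real.sqrt_nonneg _
  have hcf : 0 ≤ 2 * (8 * lr) + 2 * (2 * (((d : ℝ) - 1) * (M - 1) * M * x)) := by linarith only [hcxM, hlr]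
  have hsc : 0 ≤ Real.sqrt ((c : ℝ)) := Real.sqrt_nonneg _
  have hq1 : 0 ≤ 16 * (d : ℝ) ^ 2 * x ^ 2 := by positivity
  have hp1 : 0 ≤ (2 : ℝ) ^ (d + 1) := by positivity
  have hdK1 : 0 ≤ (d : ℝ) * (2 : ℝ) ^ d * (8 * ((d : ℝ) * M * x) ^ 2 + (16 / M ^ 2) * (8 * lr + 9 * (d : ℝ) ^ 2 * M ^ 2 * x) ^ 2) := by positivity
  have hdκ : 0 ≤ (d : ℝ) * (1 / M + 2 * (((d : ℝ) - 1) * (M - 1) * x)) ^ 2 := by positivity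
  have hs64 : 0 ≤ (64 : ℝ) ^ d := by positivity
  have hp3 : 0 ≤ (2 : ℝ) ^ (3 * d + 2) := by positivity
  have hpK2 : 0 ≤ (2 : ℝ) ^ d * ((2 : ℝ) ^ (2 * d + 4) * (d : ℝ) ^ 2 * ((d : ℝ) - 1) ^ 2 * (aU) ^ 2 + 8 * (9 * (d : ℝ) ^ 2 * M ^ 2 * x + (d : ℝ) * (8 * lr)) ^ 2) := by positivity
  have hgq : 0 ≤ 16 * (d : ℝ) * (1 / M + 2 * (((d : ℝ) - 1) * (M - 1) * x)) ^ 2 * (64 : ℝ) ^ d * (4 * (d : ℝ) ^ 2 * (M - 1) ^ 2 * x + 16 * d * lr) ^ 2 * (c : ℝ) := by positivity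
  have hgz : 0 ≤ 4 * (c : ℝ) * (4 * (d : ℝ) ^ 2 * (M - 1) ^ 2 * x + 16 * d * lr) ^ 2 + 1 := by positivity
  -- the h-bound, the y-bound, the absorption
  have hh := h_bound hd hM0 hε hc0 hy0 hh0 hG0 hZ0 hr0 hDG0 hA10 hA20 he1 he2 he3 hK hcx hscd hcf hsc hq1 hpy hZ hr hS5 hDG hJ hA heta
  have hyb' := y_bound hM0 hε hr0 hXi0 hgq hgz hGy hZy hr hyb hXi hGt (B5_le (d := d) hM0 hc0 he3 hp1 hdK1 hdκ hs64 hp3 hpK2 hZy)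
  have hbh : 0 ≤ ((3 * ((2 : ℝ) ^ (d + 1)) * (M ^ 2)⁻¹ + 3 * ((d : ℝ) * (1 / M + 2 * (((d : ℝ) - 1) * (M - 1) * x)) ^ 2) * (2 * ((64 : ℝ) ^ d) * (((2 : ℝ) ^ (3 * d + 2)) * d))) * ((c : ℝ) * (2 * M ^ 2 + 2 * (4 * (2 * ((4 * d + 5) / 10 * DS)) ^ 2 * M ^ 2) * (c : ℝ))) + (12 * d * (48 * ((d : ℝ) * (L : ℝ))) + 3 * ((d : ℝ) * (1 / M + 2 * (((d : ℝ) - 1) * (M - 1) * x)) ^ 2) * (2 * ((64 : ℝ) ^ d) * (48 * ((d : ℝ) * (L : ℝ))))) * (c : ℝ)) := by positivity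
  have hKh : 0 ≤ (1 + (1 + 8 * ε) * (2 + (16 * (d : ℝ) * (1 / M + 2 * (((d : ℝ) - 1) * (M - 1) * x)) ^ 2 * (64 : ℝ) ^ d * (4 * (d : ℝ) ^ 2 * (M - 1) ^ 2 * x + 16 * d * lr) ^ 2 * (c : ℝ)) * 8 * M ^ 2) * ((3 * ((2 : ℝ) ^ (d + 1)) * (M ^ 2)⁻¹ + 3 * ((d : ℝ) * (1 / M + 2 * (((d : ℝ) - 1) * (M - 1) * x)) ^ 2) * (2 * ((64 : ℝ) ^ d) * (((2 : ℝ) ^ (3 * d + 2)) * d))) * ((c : ℝ) * (2 * M ^ 2 + 2 * (4 * (2 * ((4 * d + 5) / 10 * DS)) ^ 2 * M ^ 2) * (c : ℝ))) + (12 * d * (48 * ((d : ℝ) * (L : ℝ))) + 3 * ((d : ℝ) * (1 / M + 2 * (((d : ℝ) - 1) * (M - 1) * x)) ^ 2) * (2 * ((64 : ℝ) ^ d) * (48 * ((d : ℝ) * (L : ℝ))))) * (c : ℝ))) := by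
    have h1 : 0 ≤ (1 + 8 * ε) * (2 + (16 * (d : ℝ) * (1 / M + 2 * (((d : ℝ) - 1) * (M - 1) * x)) ^ 2 * (64 : ℝ) ^ d * (4 * (d : ℝ) ^ 2 * (M - 1) ^ 2 * x + 16 * d * lr) ^ 2 * (c : ℝ)) * 8 * M ^ 2) * ((3 * ((2 : ℝ) ^ (d + 1)) * (M ^ 2)⁻¹ + 3 * ((d : ℝ) * (1 / M + 2 * (((d : ℝ) - 1) * (M - 1) * x)) ^ 2) * (2 * ((64 : ℝ) ^ d) * (((2 : ℝ) ^ (3 * d + 2)) * d))) * ((c : ℝ) * (2 * M ^ 2 + 2 * (4 * (2 * ((4 * d + 5) / 10 * DS)) ^ 2 * M ^ 2) * (c : ℝ))) + (12 * d * (48 * ((d : ℝ) * (L : ℝ))) + 3 * ((d : ℝ) * (1 / M + 2 * (((d : ℝ) - 1) * (M - 1) * x)) ^ 2) * (2 * ((64 : ℝ) ^ d) * (48 * ((d : ℝ) * (L : ℝ))))) * (c : ℝ)) :=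
      mul_nonneg (mul_nonneg (by linarith only [hε]) (by positivity)) hbh
    linarith only [h1]
  exact absorb hy0 hh0 hKh hh hyb' hSh hSy

end Summit.QuantumFields.BalabanUV.T4Continuum.NE3SlicePoincareBudget
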